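import Mathlib
import HarnessLib
import Summits.HubbardSuperconductivity.HubbardSuperconductivity.Theorems.KLProgrammeKLRegimeTwoVolumeLipBaseDefs

/-!
# Route `KLProgramme` — crux K3 ENGINE (stmt-HubbardSuperconductivity-20437), stub (e) proof-input «(e)-D-ROWS», G-4: CRUDE ALL-PINS PROFILE OF THE GRID DEFECT
# (seat hubbard-kl-k3c4-p1 g24, VL lane; `--supports` 20437; DROWS-SCOPE-g24 v10 §11–§12, ledger N9)

The G-4 door `…LipBaseTransferDoor.lipBaseDiff_pinned_le` and the composed (Dμ) row `…LipBaseOfGrid.klLipInputDiffSup_le_remeasured_of_grid` take two profiles of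
the GRID defect `klGridActionZero (bL) − klGridGlue (klGridActionZero L)`: `E_g` at deep grid pins (route A's datum `…LipBaseGridDefect.lipBaseGridDefect_pinned_le`)
and `ND_g` at ALL grid pins, which only enters with the far factor `τ′ = cW′/(1+Λ_T′(r_g+1))`.  This file supplies the crude `ND_g := N_g′ + N_g`:

* `sum_pinned_norm_kernel_klGridGlue_eq` — the pinned profile of the glued grid element at a fine grid pin is the coarse element's at the residue pin
  (`…TwoVolumeGluedProfiles.sum_pinned_norm_kernel_glue_eq` for `klGridBlockEquiv` / `klGridBlockEmb`);
* `sum_pinned_norm_kernel_sub_klGridGlue_le` — triangle inequality against a glued grid element;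
* **`lipBaseGridDefect_pinned_le_crude`** — the grid defect at ANY grid pin is at most `N_g′ + N_g` (`N_g′`, `N_g` the plain profiles of the fine / coarse UV grid
  actions `klGridActionZero`).

Pure bookkeeping; nothing asserts the (D) rows, stub (e), VL, K3 or superconductivity.
-/

noncomputable section

namespace Summit.HubbardSuperconductivity.HubbardSuperconductivity.Theorems.TwoVolumeLip

set_option linter.dupNamespace false -- summit = problem name (single-conjunct summit), D-0017

open Finset Literature.MathematicalPhysics.QuantumLattice GrassmannAlgebra Literature.Probability.LatticeModels
open Summit.HubbardSuperconductivity.HubbardSuperconductivity.Theorems.KLRegimeSplit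
open Summit.HubbardSuperconductivity.HubbardSuperconductivity.Theorems.EngineV8
open Summit.HubbardSuperconductivity.HubbardSuperconductivity.Theorems.TwoVolumeSource
open Summit.HubbardSuperconductivity.HubbardSuperconductivity.Theorems.TwoVolumeDefect

variable {L b M : ℕ} [NeZero L] [NeZero (b * L)]

/-- **The pinned profile of the glued grid element at a fine grid pin is the coarse element's at the residue pin.** -/
theorem sum_pinned_norm_kernel_klGridGlue_eq (W : GrassmannAlgebra ℂ (GridLeg (GridPoint L (klGridN M)))) {m : ℕ} (j : Fin m)
    (x' : GridLeg (GridPoint (b * L) (klGridN M))) :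
    ∑ Y' ∈ univ.filter (fun Y' : Fin m → GridLeg (GridPoint (b * L) (klGridN M)) => Y' j = x'), ‖kernel ℂ (klGridGlue L b M W) m Y'‖ =
      ∑ Y ∈ univ.filter (fun Y : Fin m → GridLeg (GridPoint L (klGridN M)) => Y j = (klGridBlockEquiv L b M x').2), ‖kernel ℂ W m Y‖ := by
  rw [klGridGlue_def]
  exact sum_pinned_norm_kernel_glue_eq (klGridBlockEquiv L b M) (klGridBlockEmb L b M) (fun β' v X' => klGridBlockEmb_apply β' v X') W j x'

/-- **Crude pinned profile of a difference against a glued grid element** (triangle inequality + `sum_pinned_norm_kernel_klGridGlue_eq`). -/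
theorem sum_pinned_norm_kernel_sub_klGridGlue_le {m : ℕ} (W' : GrassmannAlgebra ℂ (GridLeg (GridPoint (b * L) (klGridN M))))
    (W : GrassmannAlgebra ℂ (GridLeg (GridPoint L (klGridN M)))) (j : Fin m) (x' : GridLeg (GridPoint (b * L) (klGridN M))) :
    ∑ Y' ∈ univ.filter (fun Y' : Fin m → GridLeg (GridPoint (b * L) (klGridN M)) => Y' j = x'), ‖kernel ℂ (W' - klGridGlue L b M W) m Y'‖ ≤
      ∑ Y' ∈ univ.filter (fun Y' : Fin m → GridLeg (GridPoint (b * L) (klGridN M)) => Y' j = x'), ‖kernel ℂ W' m Y'‖ +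
        ∑ Y ∈ univ.filter (fun Y : Fin m → GridLeg (GridPoint L (klGridN M)) => Y j = (klGridBlockEquiv L b M x').2), ‖kernel ℂ W m Y‖ := by
  rw [← sum_pinned_norm_kernel_klGridGlue_eq W j x', ← sum_add_distrib]
  exact sum_le_sum fun Y' _ => by rw [kernel_sub']; exact norm_sub_le _ _

/-- **The grid defect at ANY grid pin is at most `N_g′ + N_g`.** -/
theorem lipBaseGridDefect_pinned_le_crude (β U μ : ℝ) (K : TrigPolyC4v) {n : ℕ} (q : Fin (n + 1)) {Ng Ng' : ℝ}
    (hNg : ∀ y, ∑ Y ∈ univ.filter (fun Y : Fin (n + 1) → GridLeg (GridPoint L (klGridN M)) => Y q = y),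
      ‖kernel ℂ (klGridActionZero L M β U μ K) (n + 1) Y‖ ≤ Ng)
    (hNg' : ∀ y', ∑ Y' ∈ univ.filter (fun Y' : Fin (n + 1) → GridLeg (GridPoint (b * L) (klGridN M)) => Y' q = y'),
      ‖kernel ℂ (klGridActionZero (b * L) M β U μ K) (n + 1) Y'‖ ≤ Ng')
    (y' : GridLeg (GridPoint (b * L) (klGridN M))) :
    ∑ Y' ∈ univ.filter (fun Y' : Fin (n + 1) → GridLeg (GridPoint (b * L) (klGridN M)) => Y' q = y'),
        ‖kernel ℂ (klGridActionZero (b * L) M β U μ K - klGridGlue L b M (klGridActionZero L M β U μ K)) (n + 1) Y'‖ ≤ Ng' + Ng :=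
  (sum_pinned_norm_kernel_sub_klGridGlue_le _ _ q y').trans (add_le_add (hNg' y') (hNg _))

end Summit.HubbardSuperconductivity.HubbardSuperconductivity.Theorems.TwoVolumeLip

end
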